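import Summits.AtomisticToContinuum.BoseEinsteinCondensation.Theorems.BECRichardsonGaudinRichardsonAnchorBECBornPolyPairAux
import HarnessLib

/-!
# Crux `RichardsonAnchorBEC` (stmt-AtomisticToContinuum-14805), route `BECRichardsonGaudin`, line `registered` —
# stub `stub_bornPolyPair` (U2c): the band pair annihilator on the Born trial polynomial

NOTE (worker U2c): this file proves the CORRECTED signature of `stub_bornPolyPair` — the registered one with the
extra hypothesis `0 ≤ Θ` (inserted after `0 ≤ γ`). The registered signature is false in the degenerate corner
`pairReps M R = ∅` (e.g. `M = R = 0`), `J₁ ≥ 1`, `γ > 0`, `Θ = −1/(2cJ₁)`: there `A = X_0^N`, `‖QA‖² = (N−2)! N²(N−1)²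
> 0` while the right-hand side is `(1 + 2cJ₁Θ)² · N! N(N−1) + 0 = 0`.

For the Born trial polynomial `A = Σ_{j ≤ J₁} Σ_{S ⊆ W₊, |S|=j} λ_j θ^S X^{d_S}` (`…BornDefs`) and the band pair
annihilator `Q = Σ_{p ∈ B_M} ∂_{−p}∂_p` we prove
`‖QA‖² ≤ (1−β+2cJ₁Θ)² Σ_{j<J₁} λ_j²(N−2j)!(N−2j)(N−2j−1) e_j + λ_{J₁}²(N−2J₁)!(N−2J₁)(N−2J₁−1) e_{J₁}`
(`β = 2cσ ≤ 1`, `σ = Σ_{W₊} θ`, `0 ≤ θ_m ≤ Θ` on `W₊`, `0 ≤ Θ`). Steps: (2) the coefficient of `QA` at the sector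
index `E_T = pairIndex M (N−2) T` is `b_{jT} = λ_j θ^T (N−2j)(N−2j−1)(1 − [j<J₁] 2c Σ_{W₊∖T} θ)`
(`stub_bornPolyPairCoeff`, file `…BornPolyPairAux`); (3) the support of `QA` lies in these indices
(`bornPair_support_pairAn_sum`), which are pairwise distinct with occupation factorial `(N−2j−2)!`
(`BornPolyNorms.pairIndex_injective`, `BornPolyNorms.occFactorial_pairIndex`), so
`‖QA‖² = Σ_j Σ_T (N−2j−2)! b_{jT}²` (`Fock.fockInner_eq_sum_of_subset`); (4) for `j < J₁` the bracket
`(1−β) + 2cΣ_T θ ∈ [0, 1−β+2cJ₁Θ]`, `(N−2j−2)!(N−2j)(N−2j−1) = (N−2j)!`, `Σ_{|T|=j} θ^{2T} = e_j`. [folklore]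
-/

noncomputable section

open MeasureTheory Filter
open scoped ENNReal NNReal ComplexConjugate BigOperators

namespace Summit.AtomisticToContinuum.BoseEinsteinCondensation.Cruxes.RichardsonAnchorBEC.Birth

open Literature.MathematicalPhysics.QuantumManyBody.BoseGas
open MvPolynomial

/-! ## The pair annihilator on the trial polynomial: support -/

/-- The support of `Q A` lies in the sector indices `E_T`, `T ⊆ W₊`, `|T| ≤ J₁`, at particle number
`N − 2`: a monomial of `Q A` comes from `∂_{−p}∂_p X^{d_S}`, i.e. `p = 0` (giving `E_S`) or
`p = ±m`, `m ∈ S` (giving `E_{S ∖ m}`). [folklore] -/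
theorem bornPair_support_pairAn_sum (γ L : ℝ) (M R : ℕ) {N J₁ : ℕ} (hN : 2 * J₁ + 2 ≤ N) :
    (∑ p : ↥(momentumBand M), pderiv (-p) (pderiv p (bornTrialPoly γ L M R N J₁))).support ⊆
      ((Finset.range (J₁ + 1)).biUnion fun j => (pairReps M R).powersetCard j).image
        (pairIndex M (N - 2)) := by
  classical
  intro E hE
  rw [MvPolynomial.mem_support_iff, bornPair_coeff_pairAn_sum] at hE
  obtain ⟨k, hk, hne⟩ := Finset.exists_ne_zero_of_sum_ne_zero hE
  have hc : coeff (E + Finsupp.single (toBand M (-k)) 1 + Finsupp.single (toBand M k) 1)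
      (bornTrialPoly γ L M R N J₁) ≠ 0 := fun h => hne (by rw [h, zero_mul])
  rw [bornPair_coeff_bornTrialPoly] at hc
  obtain ⟨j, hj, hne2⟩ := Finset.exists_ne_zero_of_sum_ne_zero hc
  obtain ⟨S, hS, hne3⟩ := Finset.exists_ne_zero_of_sum_ne_zero hne2
  have heq : pairIndex M N S =
      E + Finsupp.single (toBand M (-k)) 1 + Finsupp.single (toBand M k) 1 := by
    by_contra h
    exact hne3 (if_neg h)
  obtain ⟨hSW, hSc⟩ := Finset.mem_powersetCard.1 hS
  have hjJ : j ≤ J₁ := Nat.lt_succ_iff.1 (Finset.mem_range.1 hj)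
  rw [Finset.mem_image]
  by_cases hk0 : k = 0
  · subst hk0
    refine ⟨S, Finset.mem_biUnion.2 ⟨j, hj, hS⟩, ?_⟩
    have h2 := bornPair_pairIndex_add_two (M := M) (T := S) (N := N) (by rw [hSc]; omega)
    rw [neg_zero] at heq
    exact add_right_cancel (add_right_cancel (h2.trans heq))
  · have hkk : -k ≠ k := fun h => hk0 ((TorusBoseFockLayer.eq_neg_iff k).1 h.symm)
    have hk1 : k ∈ S ∨ -k ∈ S := by
      by_contra hno
      rw [not_or] at hno
      have h := DFunLike.congr_fun heq (toBand M k)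
      rw [bornPair_pairIndex_apply hSW hk, if_neg (Ne.symm hk0), if_neg hno.1, if_neg hno.2] at h
      simp only [Finsupp.add_apply, bornPair_single_apply (neg_mem_momentumBand hk) hk,
        bornPair_single_apply hk hk, if_neg hkk, reduceIte] at h
      omega
    rcases hk1 with hkS | hkS
    · refine ⟨S.erase k, Finset.mem_biUnion.2
        ⟨j - 1, Finset.mem_range.2 ((Nat.sub_le j 1).trans_lt (Nat.lt_succ_of_le hjJ)), ?_⟩, ?_⟩
      · rw [Finset.mem_powersetCard, Finset.card_erase_of_mem hkS, hSc]
        exact ⟨(Finset.erase_subset k S).trans hSW, rfl⟩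
      · have h2 := bornPair_pairIndex_insert (M := M) (N := N) (Finset.notMem_erase k S)
        rw [Finset.insert_erase hkS] at h2
        exact add_right_cancel (add_right_cancel (h2.trans heq))
    · refine ⟨S.erase (-k), Finset.mem_biUnion.2
        ⟨j - 1, Finset.mem_range.2 ((Nat.sub_le j 1).trans_lt (Nat.lt_succ_of_le hjJ)), ?_⟩, ?_⟩
      · rw [Finset.mem_powersetCard, Finset.card_erase_of_mem hkS, hSc]
        exact ⟨(Finset.erase_subset (-k) S).trans hSW, rfl⟩
      · have h2 := bornPair_pairIndex_insert (M := M) (N := N) (Finset.notMem_erase (-k) S)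
        rw [Finset.insert_erase hkS, neg_neg, add_right_comm] at h2
        exact add_right_cancel (add_right_cancel (h2.trans heq))


/-! ## Scalars -/

/-- Factorial bookkeeping: `(N−2j−2)! (N−2j)(N−2j−1) = (N−2j)!`. [folklore] -/
theorem bornPair_factorial_cast {N j : ℕ} (h : 2 * j + 2 ≤ N) :
    ((N - 2 - 2 * j).factorial : ℝ) * (((N : ℝ) - 2 * j) * ((N : ℝ) - 2 * j - 1)) =
      ((N - 2 * j).factorial : ℝ) := by
  obtain ⟨n, rfl⟩ : ∃ n, N = n + 2 * j + 2 := ⟨N - 2 * j - 2, by omega⟩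
  rw [show n + 2 * j + 2 - 2 - 2 * j = n by omega, show n + 2 * j + 2 - 2 * j = n + 2 by omega,
    Nat.factorial_succ, Nat.factorial_succ]
  push_cast
  ring

/-- `θ_m ≥ 0`. [folklore] -/
theorem bornPair_modeWeight_nonneg (L : ℝ) (m : Momentum) : 0 ≤ modeWeight L m := by
  unfold modeWeight
  positivity

/-- `c ≥ 0` for `γ ≥ 0`, `L > 0` (the window bubble is non-negative). [folklore] -/
theorem bornPair_bornCoupling_nonneg {γ L : ℝ} (hγ : 0 ≤ γ) (hL : 0 < L) (M R : ℕ) :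
    0 ≤ bornCoupling γ L M R := by
  unfold bornCoupling windowBubble
  have hs : 0 ≤ ∑ m ∈ pairWindow M R, modeWeight L m :=
    Finset.sum_nonneg fun m _ => bornPair_modeWeight_nonneg L m
  positivity

/-! ## The Fock norm of `Q A` -/

/-- **Step (3).** `‖QA‖² = Σ_{j ≤ J₁} Σ_{T ⊆ W₊, |T| = j} (N−2j−2)! · b_{jT}²` with the real coefficients
`b_{jT} = λ_j θ^T (N−2j)(N−2j−1)(1 − [j<J₁] 2c Σ_{W₊∖T} θ)` of `stub_bornPolyPairCoeff`: the indices `E_T`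
are pairwise distinct with occupation factorial `(N−2j−2)!`. [folklore] -/
theorem bornPair_fockInner_pairAn_sum (γ L : ℝ) (M R : ℕ) {N J₁ : ℕ} (hN : 2 * J₁ + 2 ≤ N) :
    Fock.fockInner
        (∑ p : ↥(momentumBand M), pderiv (-p) (pderiv p (bornTrialPoly γ L M R N J₁)))
        (∑ p : ↥(momentumBand M), pderiv (-p) (pderiv p (bornTrialPoly γ L M R N J₁))) =
      ((∑ j ∈ Finset.range (J₁ + 1), ∑ T ∈ (pairReps M R).powersetCard j,
          ((N - 2 - 2 * j).factorial : ℝ) *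
            (bornCoeff γ L M R N j * (∏ m ∈ T, modeWeight L m) *
              (((N : ℝ) - 2 * j) * ((N : ℝ) - 2 * j - 1)) *
              (1 - if j < J₁ then
                2 * bornCoupling γ L M R * ∑ m ∈ pairReps M R \ T, modeWeight L m else 0)) ^ 2 :
          ℝ) : ℂ) := by
  classical
  rw [Fock.fockInner_eq_sum_of_subset _ (bornPair_support_pairAn_sum γ L M R hN),
    Finset.sum_image fun T hT T' hT' h => ?_, Finset.sum_biUnion fun i _ j _ hij =>
      Finset.pairwise_disjoint_powersetCard _ hij]
  · push_cast
    refine Finset.sum_congr rfl fun j hj => Finset.sum_congr rfl fun T hT => ?_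
    obtain ⟨hTW, hTc⟩ := Finset.mem_powersetCard.1 hT
    have hjJ : j ≤ J₁ := Nat.lt_succ_iff.1 (Finset.mem_range.1 hj)
    rw [BornPolyNorms.occFactorial_pairIndex hTW,
      stub_bornPolyPairCoeff γ L M R N J₁ T hN hTW (hTc ▸ hjJ), hTc, Complex.conj_ofReal]
    push_cast
    ring
  · obtain ⟨j, -, hj⟩ := Finset.mem_biUnion.1 (Finset.mem_coe.1 hT)
    obtain ⟨j', -, hj'⟩ := Finset.mem_biUnion.1 (Finset.mem_coe.1 hT')
    exact BornPolyNorms.pairIndex_injective (Finset.mem_powersetCard.1 hj).1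
      (Finset.mem_powersetCard.1 hj').1 h

/-! ## The stub -/

/-- **Stub U2c `stub_bornPolyPair` — the pair operator on the Born trial polynomial.** With
`c = bornCoupling`, `σ = Σ_{W₊} θ`, `β = 2cσ ≤ 1` and a bound `0 ≤ Θ`, `θ_m ≤ Θ` on `W₊`, the band pair operator
`Q = Σ_{p ∈ B_M} ∂_{−p}∂_p` satisfies
`‖QA‖² ≤ (1−β+2cJ₁Θ)² Σ_{j<J₁} λ_j²(N−2j)!(N−2j)(N−2j−1) e_j + λ_{J₁}²(N−2J₁)!(N−2J₁)(N−2J₁−1) e_{J₁}`: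
by steps (2)–(3) (`stub_bornPolyPairCoeff`, `bornPair_fockInner_pairAn_sum`)
`‖QA‖² = Σ_j Σ_T (N−2j−2)! b_{jT}²`, and (step (4)) for `j < J₁` the bracket
`1 − 2cΣ_{W₊∖T}θ = (1−β) + 2c Σ_T θ` lies in `[0, 1−β+2cJ₁Θ]` (`0 ≤ θ_m ≤ Θ`, `|T| = j ≤ J₁`, `c ≥ 0`), while
`(N−2j−2)!(N−2j)(N−2j−1) = (N−2j)!` and `Σ_{|T|=j} θ^{2T} = e_j`. [folklore] -/
theorem stub_bornPolyPair :
    ∀ (γ L Θ : ℝ) (M R N J₁ : ℕ), 0 < L → 0 ≤ γ → 0 ≤ Θ → 2 * J₁ + 2 ≤ N →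
      (∀ m ∈ pairReps M R, modeWeight L m ≤ Θ) →
      2 * bornCoupling γ L M R * ∑ m ∈ pairReps M R, modeWeight L m ≤ 1 →
      (Fock.fockInner
          (∑ p : ↥(momentumBand M), MvPolynomial.pderiv (-p) (MvPolynomial.pderiv p (bornTrialPoly γ L M R N J₁)))
          (∑ p : ↥(momentumBand M), MvPolynomial.pderiv (-p) (MvPolynomial.pderiv p (bornTrialPoly γ L M R N J₁)))).re ≤
        (1 - 2 * bornCoupling γ L M R * ∑ m ∈ pairReps M R, modeWeight L m +
            2 * bornCoupling γ L M R * J₁ * Θ) ^ 2 *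
          ∑ j ∈ Finset.range J₁, bornCoeff γ L M R N j ^ 2 * ((N - 2 * j).factorial : ℝ) *
            (((N : ℝ) - 2 * j) * ((N : ℝ) - 2 * j - 1)) * pairEsymm L M R j +
        bornCoeff γ L M R N J₁ ^ 2 * ((N - 2 * J₁).factorial : ℝ) *
          (((N : ℝ) - 2 * J₁) * ((N : ℝ) - 2 * J₁ - 1)) * pairEsymm L M R J₁ := by
  intro γ L Θ M R N J₁ hL hγ hΘ hN hθΘ hβ
  rw [bornPair_fockInner_pairAn_sum γ L M R hN, Complex.ofReal_re, Finset.sum_range_succ]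
  have hc : 0 ≤ bornCoupling γ L M R := bornPair_bornCoupling_nonneg hγ hL M R
  have hθ : ∀ m, 0 ≤ modeWeight L m := bornPair_modeWeight_nonneg L
  set c := bornCoupling γ L M R
  set σ := ∑ m ∈ pairReps M R, modeWeight L m
  refine add_le_add ?_ (le_of_eq ?_)
  · rw [Finset.mul_sum]
    refine Finset.sum_le_sum fun j hj => ?_
    have hjJ : j < J₁ := Finset.mem_range.1 hj
    have hj2 : 2 * j + 2 ≤ N := by omega
    have hjR : (2 : ℝ) * j + 2 ≤ N := by exact_mod_cast hj2
    have hP : 0 ≤ ((N : ℝ) - 2 * j) * ((N : ℝ) - 2 * j - 1) :=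
      mul_nonneg (by linarith) (by linarith)
    have hfac := bornPair_factorial_cast hj2
    rw [pairEsymm, Finset.mul_sum ((pairReps M R).powersetCard j),
      Finset.mul_sum ((pairReps M R).powersetCard j)]
    refine Finset.sum_le_sum fun T hT => ?_
    obtain ⟨hTW, hTc⟩ := Finset.mem_powersetCard.1 hT
    rw [if_pos hjJ, Finset.sum_sdiff_eq_sub hTW, Finset.prod_pow]
    set w := ∑ m ∈ T, modeWeight L m
    set th := ∏ m ∈ T, modeWeight L m
    set lam := bornCoeff γ L M R N j
    set P := ((N : ℝ) - 2 * j) * ((N : ℝ) - 2 * j - 1)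
    have hw0 : 0 ≤ w := Finset.sum_nonneg fun m _ => hθ m
    have hwΘ : w ≤ J₁ * Θ :=
      calc w ≤ ∑ _m ∈ T, Θ := Finset.sum_le_sum fun m hm => hθΘ m (hTW hm)
        _ = j * Θ := by rw [Finset.sum_const, hTc, nsmul_eq_mul]
        _ ≤ J₁ * Θ := mul_le_mul_of_nonneg_right (by exact_mod_cast hjJ.le) hΘ
    have hb1 : 0 ≤ 1 - 2 * c * (σ - w) := by nlinarith [mul_nonneg hc hw0]
    have hb2 : 1 - 2 * c * (σ - w) ≤ 1 - 2 * c * σ + 2 * c * J₁ * Θ := by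
      nlinarith [mul_le_mul_of_nonneg_left hwΘ hc]
    have hsq := pow_le_pow_left₀ hb1 hb2 2
    have hK : 0 ≤ lam ^ 2 * (((N - 2 - 2 * j).factorial : ℝ) * P) * P * th ^ 2 := by
      rw [hfac]
      exact mul_nonneg (mul_nonneg (mul_nonneg (sq_nonneg _) (Nat.cast_nonneg _)) hP) (sq_nonneg _)
    calc ((N - 2 - 2 * j).factorial : ℝ) * (lam * th * P * (1 - 2 * c * (σ - w))) ^ 2
        = lam ^ 2 * (((N - 2 - 2 * j).factorial : ℝ) * P) * P * th ^ 2 *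
            (1 - 2 * c * (σ - w)) ^ 2 := by ring
      _ ≤ lam ^ 2 * (((N - 2 - 2 * j).factorial : ℝ) * P) * P * th ^ 2 *
            (1 - 2 * c * σ + 2 * c * J₁ * Θ) ^ 2 := mul_le_mul_of_nonneg_left hsq hK
      _ = (1 - 2 * c * σ + 2 * c * J₁ * Θ) ^ 2 * (lam ^ 2 * ((N - 2 * j).factorial : ℝ) * P * th ^ 2) := by
        rw [hfac]
        ring
  · simp only [lt_self_iff_false, if_false, sub_zero, mul_one]
    rw [pairEsymm, Finset.mul_sum ((pairReps M R).powersetCard J₁)]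
    refine Finset.sum_congr rfl fun T _ => ?_
    rw [Finset.prod_pow, ← bornPair_factorial_cast hN]
    ring

end Summit.AtomisticToContinuum.BoseEinsteinCondensation.Cruxes.RichardsonAnchorBEC.Birth

end
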